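import Literature.NumberTheory.CubicFields.CubicFieldDiscriminant7255Primes
import HarnessLib

/-!
# The cubic field of discriminant `−7255`, II: the primes of norm `≤ 24` and ★ class number ONE — `2 = 𝔭_a𝔭_b𝔭_c` with principal `𝔭`'s generated by
# `-362 − 90θ − 33δ`, `208 + 1241θ − 2332δ`, `-1410168 − 350627θ − 128535δ` (Dedekind's splitting), the odd primes by Dedekind–Kummer through `θ`

Sequel of `CubicFieldDiscriminant7255Primes.lean` (att-p4 g46, cell `bsd-f1-sign2`).  THEOREMS ONLY.  The Minkowski bound of `F` (`d_F = −7255`, signature `(1,1)`) is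
`(4/π)(6/27)√7255 < 25`; the primes above `2` are the three principal primes generated by the norm-`±2` elements above (their product is `2` times a unit; norms
by the norm form on `1, α, α²`), and every prime of norm `≤ 24` above an odd `p` is principal by Dedekind–Kummer through `θ` (`p ∤ 2 ⊇ [𝓞_F : ℤ[θ]]`) with explicit
generators.  Hence `𝓞_F` is a PID and ★ `h_F = 1` — the datum `2 ∤ h(ℚ(β))` of the split-stratum doors of route `AlignedTransportAtTwo`.
[cite: Marcus2018, Ch. 3, Thm. 27 and Exercise 21; Ch. 5, Thm. 37 and Cor. 2] [cite: LMFDB, number field 3.1.7255.1 (class number 1)]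
-/

noncomputable section

open Polynomial NumberField NumberField.InfinitePlace Ideal Module Real
open Literature.NumberTheory.NumberFields
open Literature.NumberTheory.NumberFields.MonicCubic

namespace Literature.NumberTheory.CubicFields.CubicDisc7255

section NumberField

variable {F : Type*} [Field F] [NumberField F] {α : F}

/-! ## §3 (continued) The primes of norm `≤ 24` are principal: `5 < p ≤ 24` -/

/-- **Every prime of `𝓞_F` above `7` is principal**: `7` is inert (`f` irreducible mod `7`, `7 ∤ exponent`), so `P = (7)`.
[cite: Marcus2018, Ch. 3, Thm. 27] [cite: LMFDB, number field 3.1.7255.1 (class number 1)] -/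
theorem isPrincipal_of_mem_primesOver_7 (h3 : finrank ℚ F = 3) (hα : aeval α (poly 6 19 (-10)) = 0) {P : Ideal (𝓞 F)}
    (hP : P ∈ primesOver (span {((7 : ℕ) : ℤ)}) (𝓞 F)) : Submodule.IsPrincipal P := by
  have hPeq := eq_span_of_no_root' irreducible_polyQ hα (by norm_num : Nat.Prime 7)
    (not_dvd_exponent h3 hα (by norm_num) (by norm_num)) hP no_root_7
  exact ⟨⟨((7 : ℕ) : 𝓞 F), by rw [hPeq, Ideal.submodule_span_eq]⟩⟩

/-- `f` has no root modulo `11`. [cite: Marcus2018, Ch. 3, Thm. 27] -/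
theorem no_root_11' :
    ∀ r : ZMod 11, r ^ 3 + ((6 : ℤ) : ZMod 11) * r ^ 2 + ((19 : ℤ) : ZMod 11) * r + ((-10 : ℤ) : ZMod 11) ≠ 0 := by
  decide

/-- **Every prime of `𝓞_F` above `11` is principal**: `11` is inert (`f` irreducible mod `11`, `11 ∤ exponent`), so `P = (11)`.
[cite: Marcus2018, Ch. 3, Thm. 27] [cite: LMFDB, number field 3.1.7255.1 (class number 1)] -/
theorem isPrincipal_of_mem_primesOver_11 (h3 : finrank ℚ F = 3) (hα : aeval α (poly 6 19 (-10)) = 0) {P : Ideal (𝓞 F)}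
    (hP : P ∈ primesOver (span {((11 : ℕ) : ℤ)}) (𝓞 F)) : Submodule.IsPrincipal P := by
  have hPeq := eq_span_of_no_root' irreducible_polyQ hα (by norm_num : Nat.Prime 11)
    (not_dvd_exponent h3 hα (by norm_num) (by norm_num)) hP no_root_11'
  exact ⟨⟨((11 : ℕ) : 𝓞 F), by rw [hPeq, Ideal.submodule_span_eq]⟩⟩

/-- `f` has no root modulo `13`. [cite: Marcus2018, Ch. 3, Thm. 27] -/
theorem no_root_13' :
    ∀ r : ZMod 13, r ^ 3 + ((6 : ℤ) : ZMod 13) * r ^ 2 + ((19 : ℤ) : ZMod 13) * r + ((-10 : ℤ) : ZMod 13) ≠ 0 := by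
  decide

/-- **Every prime of `𝓞_F` above `13` is principal**: `13` is inert (`f` irreducible mod `13`, `13 ∤ exponent`), so `P = (13)`.
[cite: Marcus2018, Ch. 3, Thm. 27] [cite: LMFDB, number field 3.1.7255.1 (class number 1)] -/
theorem isPrincipal_of_mem_primesOver_13 (h3 : finrank ℚ F = 3) (hα : aeval α (poly 6 19 (-10)) = 0) {P : Ideal (𝓞 F)}
    (hP : P ∈ primesOver (span {((13 : ℕ) : ℤ)}) (𝓞 F)) : Submodule.IsPrincipal P := by
  have hPeq := eq_span_of_no_root' irreducible_polyQ hα (by norm_num : Nat.Prime 13)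
    (not_dvd_exponent h3 hα (by norm_num) (by norm_num)) hP no_root_13'
  exact ⟨⟨((13 : ℕ) : 𝓞 F), by rw [hPeq, Ideal.submodule_span_eq]⟩⟩

/-- `f` has no root modulo `17`. [cite: Marcus2018, Ch. 3, Thm. 27] -/
theorem no_root_17' :
    ∀ r : ZMod 17, r ^ 3 + ((6 : ℤ) : ZMod 17) * r ^ 2 + ((19 : ℤ) : ZMod 17) * r + ((-10 : ℤ) : ZMod 17) ≠ 0 := by
  decide

/-- **Every prime of `𝓞_F` above `17` is principal**: `17` is inert (`f` irreducible mod `17`, `17 ∤ exponent`), so `P = (17)`.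
[cite: Marcus2018, Ch. 3, Thm. 27] [cite: LMFDB, number field 3.1.7255.1 (class number 1)] -/
theorem isPrincipal_of_mem_primesOver_17 (h3 : finrank ℚ F = 3) (hα : aeval α (poly 6 19 (-10)) = 0) {P : Ideal (𝓞 F)}
    (hP : P ∈ primesOver (span {((17 : ℕ) : ℤ)}) (𝓞 F)) : Submodule.IsPrincipal P := by
  have hPeq := eq_span_of_no_root' irreducible_polyQ hα (by norm_num : Nat.Prime 17)
    (not_dvd_exponent h3 hα (by norm_num) (by norm_num)) hP no_root_17'
  exact ⟨⟨((17 : ℕ) : 𝓞 F), by rw [hPeq, Ideal.submodule_span_eq]⟩⟩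

/-- `(19, θ + 12) = (6451 + 1604 * θ + 588 * δ)`, an element of norm `19` (identities checked in `F`, `δ = (α ^ 2 + α) / 2`).
[cite: Marcus2018, Ch. 3, Thm. 27] -/
theorem span_19_lin12_eq (hα : aeval α (poly 6 19 (-10)) = 0) :
    span {(19 : 𝓞 F), thetaInt hα + 12} = span {6451 + 1604 * thetaInt hα + 588 * thetaInt (delta_root hα)} := by
  apply le_antisymm
  · rw [span_le]
    rintro x hx
    rcases hx with rfl | hx
    · exact mem_span_singleton'.mpr ⟨-31 + 36 * thetaInt hα + 44 * thetaInt (delta_root hα), by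
          rw [RingOfIntegers.ext_iff]
          simp only [map_mul, map_add, map_neg, map_ofNat, MonicCubic.thetaInt, RingOfIntegers.map_mk]
          linear_combination (((20000 : F)) + ((6468 : F)) * α) * cubic_eq hα⟩
    · rw [Set.mem_singleton_iff.mp hx]
      exact mem_span_singleton'.mpr ⟨-8 + 3 * thetaInt hα + 20 * thetaInt (delta_root hα), by
          rw [RingOfIntegers.ext_iff]
          simp only [map_mul, map_add, map_neg, map_ofNat, MonicCubic.thetaInt, RingOfIntegers.map_mk]
          linear_combination (((5162 : F)) + ((2940 : F)) * α) * cubic_eq hα⟩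
  · rw [span_singleton_le_iff_mem, mem_span_pair]
    exact ⟨-2402910 - 188909 * thetaInt (delta_root hα), 3591463 + 512837 * thetaInt (delta_root hα), by
        rw [RingOfIntegers.ext_iff]
        simp only [map_mul, map_add, map_sub, map_neg, map_ofNat, MonicCubic.thetaInt, RingOfIntegers.map_mk]
        linear_combination (((512837 : F) / 2)) * cubic_eq hα⟩

/-- **Every prime of `𝓞_F` above `19` with `19^f ≤ 24` is principal** (Dedekind–Kummer through `θ`, `19 ∤ exponent`, with `polyMod_19` and the generators above).
[cite: Marcus2018, Ch. 3, Thm. 27] [cite: LMFDB, number field 3.1.7255.1 (class number 1)] -/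
theorem isPrincipal_of_mem_primesOver_19 (h3 : finrank ℚ F = 3) (hα : aeval α (poly 6 19 (-10)) = 0) {P : Ideal (𝓞 F)}
    (hP : P ∈ primesOver (span {((19 : ℕ) : ℤ)}) (𝓞 F))
    (hle : 19 ^ P.inertiaDeg ℤ ≤ 24) : Submodule.IsPrincipal P := by
  haveI : Fact (Nat.Prime 19) := ⟨by norm_num⟩
  obtain ⟨Qb, hirr, hmon, hdvd, hdeg, hspan⟩ :=
    exists_factor_of_mem_primesOver' irreducible_polyQ hα (by norm_num : Nat.Prime 19)
      (not_dvd_exponent h3 hα (by norm_num) (by norm_num)) hP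
  rw [polyMod_19] at hdvd
  rcases hirr.prime.dvd_or_dvd hdvd with h | h
  · have hirr1 : Irreducible (X + 12 : (ZMod 19)[X]) := by
      rw [show (X + 12 : (ZMod 19)[X]) = X - C (-12) by rw [map_neg, map_ofNat]; ring]
      exact irreducible_X_sub_C _
    have hQb : Qb = X + 12 := eq_of_monic_of_associated hmon (by monicity!) (hirr.associated_of_dvd hirr1 h)
    have hPeq := hspan (X + C 12) (by rw [hQb]; simp [map_ofNat])
    rw [show aeval (thetaInt hα) (X + C 12 : ℤ[X]) = thetaInt hα + 12 by
        simp only [map_add, aeval_X, aeval_C, algebraMap_int_eq, Int.coe_castRingHom, Int.cast_ofNat], Nat.cast_ofNat, span_19_lin12_eq hα] at hPeq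
    exact ⟨⟨6451 + 1604 * thetaInt hα + 588 * thetaInt (delta_root hα), by rw [hPeq, Ideal.submodule_span_eq]⟩⟩
  · have hQb : Qb = X ^ 2 + 13 * X + 15 :=
      eq_of_monic_of_associated hmon (by monicity!) (hirr.associated_of_dvd CubicDisc4827.irreducible_quad_19 h)
    exfalso
    have hd2 : (X ^ 2 + 13 * X + 15 : (ZMod 19)[X]).natDegree = 2 := by compute_degree!
    rw [hdeg, hQb, hd2] at hle
    norm_num at hle

/-- `f` has no root modulo `23`. [cite: Marcus2018, Ch. 3, Thm. 27] -/
theorem no_root_23' :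
    ∀ r : ZMod 23, r ^ 3 + ((6 : ℤ) : ZMod 23) * r ^ 2 + ((19 : ℤ) : ZMod 23) * r + ((-10 : ℤ) : ZMod 23) ≠ 0 := by
  decide

/-- **Every prime of `𝓞_F` above `23` is principal**: `23` is inert (`f` irreducible mod `23`, `23 ∤ exponent`), so `P = (23)`.
[cite: Marcus2018, Ch. 3, Thm. 27] [cite: LMFDB, number field 3.1.7255.1 (class number 1)] -/
theorem isPrincipal_of_mem_primesOver_23 (h3 : finrank ℚ F = 3) (hα : aeval α (poly 6 19 (-10)) = 0) {P : Ideal (𝓞 F)}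
    (hP : P ∈ primesOver (span {((23 : ℕ) : ℤ)}) (𝓞 F)) : Submodule.IsPrincipal P := by
  have hPeq := eq_span_of_no_root' irreducible_polyQ hα (by norm_num : Nat.Prime 23)
    (not_dvd_exponent h3 hα (by norm_num) (by norm_num)) hP no_root_23'
  exact ⟨⟨((23 : ℕ) : 𝓞 F), by rw [hPeq, Ideal.submodule_span_eq]⟩⟩

/-! ## §4 Class number one -/

/-- **`𝓞_F` is a principal ideal domain.**  Minkowski: every ideal class contains an ideal of norm `≤ (4/π)(6/27)√7255 < 25`, and the primes
`P` above `p ≤ 24` with `p^f ≤ 24` are principal (§3). [cite: LMFDB, number field 3.1.7255.1 (class number 1)] [cite: Marcus2018, Ch. 5, Thm. 37 and Cor. 2] -/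
theorem isPrincipalIdealRing (h3 : finrank ℚ F = 3) (hα : aeval α (poly 6 19 (-10)) = 0) : IsPrincipalIdealRing (𝓞 F) := by
  apply RingOfIntegers.isPrincipalIdealRing_of_isPrincipal_of_pow_le_of_mem_primesOver_of_mem_Icc
  rw [nrComplexPlaces_eq_one h3 hα, h3, discr_eq h3 hα]
  intro p hp hpr P hP hle
  obtain ⟨hp1, hpM⟩ := Finset.mem_Icc.mp hp
  have hreal : (4 / π) ^ 1 * ((((3 : ℕ).factorial : ℕ) : ℝ) / ((3 : ℕ) : ℝ) ^ (3 : ℕ) * √|((-7255 : ℤ) : ℝ)|) < ((25 : ℕ) : ℝ) := by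
    have hπ := Real.pi_gt_d2
    have hπ0 := Real.pi_pos
    have hs : √(7255 : ℝ) < 85.18 := by
      rw [Real.sqrt_lt' (by norm_num)]; norm_num
    have hs0 : 0 ≤ √(7255 : ℝ) := Real.sqrt_nonneg _
    have habs : |((-7255 : ℤ) : ℝ)| = 7255 := by norm_num
    rw [habs]
    norm_num [Nat.factorial]
    rw [div_mul_eq_mul_div, div_lt_iff₀ hπ0]
    nlinarith
  have hfl := Nat.lt_succ_iff.mp ((Nat.floor_lt' (by norm_num)).mpr hreal)
  have hpB : p ≤ 24 := hpM.trans hfl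
  have hleB : p ^ P.inertiaDeg ℤ ≤ 24 := hle.trans hfl
  clear hpM hle hp
  interval_cases p
  · exact absurd hpr (by norm_num)
  · exact isPrincipal_of_mem_primesOver_2 h3 hα hP
  · exact isPrincipal_of_mem_primesOver_3 h3 hα hP
  · exact absurd hpr (by norm_num)
  · exact isPrincipal_of_mem_primesOver_5 h3 hα hP
  · exact absurd hpr (by norm_num)
  · exact isPrincipal_of_mem_primesOver_7 h3 hα hP
  · exact absurd hpr (by norm_num)
  · exact absurd hpr (by norm_num)
  · exact absurd hpr (by norm_num)
  · exact isPrincipal_of_mem_primesOver_11 h3 hα hP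
  · exact absurd hpr (by norm_num)
  · exact isPrincipal_of_mem_primesOver_13 h3 hα hP
  · exact absurd hpr (by norm_num)
  · exact absurd hpr (by norm_num)
  · exact absurd hpr (by norm_num)
  · exact isPrincipal_of_mem_primesOver_17 h3 hα hP
  · exact absurd hpr (by norm_num)
  · exact isPrincipal_of_mem_primesOver_19 h3 hα hP hleB
  · exact absurd hpr (by norm_num)
  · exact absurd hpr (by norm_num)
  · exact absurd hpr (by norm_num)
  · exact isPrincipal_of_mem_primesOver_23 h3 hα hP
  · exact absurd hpr (by norm_num)

/-- ★ **`h_F = 1`: the cubic field of discriminant `−7255` has class number one** (`𝓞_F = ℤ ⊕ ℤθ ⊕ ℤδ`, no power integral basis found).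
[cite: LMFDB, number field 3.1.7255.1 (class number 1)] -/
theorem classNumber_eq_one (h3 : finrank ℚ F = 3) (hα : aeval α (poly 6 19 (-10)) = 0) : classNumber F = 1 :=
  (classNumber_eq_one_iff (K := F)).mpr (isPrincipalIdealRing h3 hα)

/-- **`h_F` is odd** (the form consumed by the `2`-adic doors of cell `bsd-f1-sign2`). [cite: LMFDB, number field 3.1.7255.1 (class number 1)] -/
theorem not_two_dvd_classNumber (h3 : finrank ℚ F = 3) (hα : aeval α (poly 6 19 (-10)) = 0) : ¬ 2 ∣ classNumber F := by
  rw [classNumber_eq_one h3 hα]; decide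

end NumberField

end Literature.NumberTheory.CubicFields.CubicDisc7255

end
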